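import Summits.BirchSwinnertonDyer.BirchSwinnertonDyer.Theses.TangentCone
import Summits.BirchSwinnertonDyer.BirchSwinnertonDyer.Theses.SelmerRank
import Literature.NumberTheory.EllipticCurves.KuriharaNumber
import Literature.NumberTheory.EllipticCurves.KatoKolyvaginPrimes
import Literature.NumberTheory.EllipticCurves.CuspFormLFunction
import Literature.NumberTheory.EllipticCurves.CongruentNumberCurveRootNumber

/-!
# Disproof of `SelmerRankLB` (stmt-BirchSwinnertonDyer-0131) — findings of the crux disprover, cycle 1

Seat `refuter-cdisprove-stmt-BirchSwinnertonDyer-0131-0`, 2026-08-17. Payload route `TangentCone`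
(the item is shared verbatim by SelmerRank / ShadowIsolation / ToricShedding / FrozenTwin /
TangentCone / VerticalContact; the six `def SelmerRankLB` bodies are `rfl`-equal, see
`CruxAttackProbes.lean` of the earlier crux-attack seat, whose `S → C` probe this file EXTENDS and
does not repeat beyond what the kernel needs here).

The crux: `∀ W p, 5 ≤ p → good at p → p ∤ a_p → ρ̄_{E,p} onto → r_an(W) ≤ corank_{ℤ_p} Sel_{p^∞}(W/ℚ)`.

## Findings (all theorems below are sorry-free; prose only in docstrings)

* **(A) No hypothesis is load-bearing for TRUTH.** `SelmerRankLBNaked` (every elliptic `W`, every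
  prime `p`, no minimality / `p ≥ 5` / good / ordinary / big-image condition) already follows from
  the summit statement `BirchSwinnertonDyer` through Greenberg's corank identity
  `corank Sel_{p^∞} = rank + corank Ш[p^∞]`, PROVED in tree
  (`WeierstrassCurve.selmerCorank_eq_mordellWeilRank_add_holds`): `naked_of_summit`. Contrapositives
  `not_summit_of_not_naked`, `not_summit_of_not_selmerRankLB`: ANY counterexample to the crux — even
  with all five hypotheses dropped — is a counterexample to the Lean summit. Consequently NO
  `selmerRankLB_false_without_<H>` theorem can exist in a consistent tree unless `¬ BirchSwinnertonDyer`
  is provable; the five hypotheses are load-bearing only for PROVABILITY (they are exactly the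
  hypotheses of the known cases `r_an ≤ 3`: `p`-parity + corank-0/1 `p`-converses).
* **(B) Where the conclusion is provably non-trivial in tree.** `r_an(W) ≥ 1` is provable in the
  tree today only for the CM congruent-number curves `E_n : y² = x³ - n²x`, `n ≡ 5, 7 (mod 8)`
  square-free (`analyticRank_congruentNumberCurve_ne_zero`, Hecke continuation proved in tree), which
  are globally minimal with good reduction at `p ∤ 2n` (`cm_instances_with_positive_analyticRank`).
  They are EXCLUDED from the crux by `HasSurjectiveModNGaloisRep p` (CM ⇒ image in the normaliser
  of a Cartan for every odd `p`; on paper), and even for the naked statement they give no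
  counterexample: `rank E_n(ℚ) ≥ 1` for these `n` (5, 7, 13, … are congruent numbers), so
  `corank ≥ rank ≥ 1`, while `r_an(E_n) = 1` exactly is out of reach (needs `L'(E_n,1) ≠ 0`).
  For every non-CM curve `r_an` is not computable in Lean (the entire continuation is the unproved
  fact `hasEntireLFunction_rat` ⇐ modularity), so NO finite instance of the crux can be decided
  either way in the present tree: an unconditional `¬ SelmerRankLB` is unreachable, full stop.
* **(C) Tightness and strengthenings.** Given the summit, `corank = r_an ↔ corank Ш[p^∞] = 0`
  (`selmerCorank_eq_analyticRank_iff_of_summit`): the LB inequality is strict exactly on the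
  divisible part of `Ш[p^∞]` and carries no `Ш`-information. Natural strengthenings, all
  BSD-implied, none refutable: all primes (incl. bad,
  supersingular, `2`, `3`) and all models — `naked_of_summit`; equality `r_an = corank` = the sibling
  crux `SelmerRankUB` ∧ this (open, BSD+Ш-finite-implied); `p`-Selmer-rank form
  `r_an ≤ dim Sel_p − dim E(ℚ)[p]` (BSD-implied); number fields (BSD/K-implied). The only cheaply
  FALSE strengthening is dropping `[W.IsElliptic]` (junk `L`-series / junk Selmer of singular
  cubics), which nobody wants.
* **(D) Targets = the five stubs of the picked line `kurihara_order`** (skeleton sha f1ba77bd…,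
  `Lines/kurihara_order.lean`; restated verbatim below as `Stub…` because the `Lines` module is not
  a build target of the farm). Kernel-checked:
  - `stubKV_of_summit_of_kim` : `BirchSwinnertonDyer → KimCorankLeOfNonvanishing → StubKV`, where
    `StubKV` = "`ν(n) < r_an ⇒ δ_n^{(k)} = 0`" is the conjunction of V0∧V1∧V2a∧V2b with ALL parity /
    size side conditions dropped, and `KimCorankLeOfNonvanishing` is the tree-typed form of the
    "`δ̃_n ≠ 0 ⇒ corank ≤ ν(n)`" half of Kim 2022 Thm 1.9 (1) (a THEOREM in print). Hence the open
    stub V2b (`StubDeltaEvenGap`, = `stubDeltaEvenGap_of_stubKV`) cannot be false unless the Lean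
    summit or Kim's theorem is: like the crux, V2b is refutation-proof relative to BSD; a disproof
    attempt on V2b is a disproof attempt on BSD-rank for a curve of analytic rank ≥ 4.
  - `kuriharaNumber_eq_zero_of_forall_surjective` : at a level `n` all of whose prime factors `ℓ`
    satisfy `p^k ∣ ℓ - 1` (every `n ∈ 𝒩_k`), "`δ_n(ψ) = 0` for all SURJECTIVE logarithms `ψ`" already
    gives "`δ_n(ψ) = 0` for ALL `ψ`": the hypothesis `hψ` of V0/V1/V2a/V2b is decoration (the stubs
    may be restated without it; conversely stub K's `∃ ψ surjective` is equivalent to `∃ ψ`,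
    `exists_surjective_ne_zero_of_ne_zero`). Mutation record, not an error. Likewise the level
    bound `1 ≤ k` (`stubDeltaEvenGap_iff_anyLevel`: `ℤ/p^0` is the zero ring).
  - LOAD-BEARING hypothesis of V2b identified: of its own side conditions only the threshold
    `ν(n) < r_an` matters — `analyticRank_le_one_of_noUpper` : K → V0 → V1 → V2a → (V2b with the
    threshold dropped) → every curve in the crux's range has `r_an ≤ 1` (false on paper at 389a1,
    p = 5; with the summit, `mordellWeilRank_le_one_of_noUpper_of_summit`). Dropping `2 ≤ ν` or the
    parity condition only re-absorbs V0/V2a resp. V1 (true in print): not load-bearing.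
  - Typing audit of V1 against Kim 2022 §3.5 (PDF p. 19, display before Prop. 3.16:
    "`w(E)·(−1)^{ν(n)}·δ̃_n = δ̃_n ∈ ℤ_p/I_nℤ_p`", unconditional for `n ∈ 𝒩_1`; `I_n ⊆ p^kℤ_p` for
    `n ∈ 𝒩_k`, so vanishing mod `I_n` gives vanishing mod `p^k`): V1 is typed faithfully; the tree's
    period `Ω⁺_f` differs from Kim's Néron period by a `p`-adic unit at good `p ≥ 5` with `E[p]`
    irreducible (`IsNewformOf.norm_ratPlusSymbol_le_one`, Manin constant prime to `p`). No stub is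
    mis-stated as far as paper analysis reaches; none is decidable in Lean (every stub speaks of
    `ratPlusSymbol`, a real period integral).
* **(E) Near-misses**: none. Nothing in this file is sorried.
* **(F) Numerics (PARI `msfromell`; jobs j023832 = `kuri.gp`, j023842 = `kuri2.gp`; stdout attached to the
  item).** Mod-`p` Kurihara numbers `δ_n^{(1)} = Σ_{a ∈ (ℤ/n)ˣ} [a/n]⁺ Π_{ℓ∣n} log_ℓ(a) (mod p)` at
  Kolyvagin levels `n ∈ 𝒩_1` built from the six smallest `ℓ ∈ 𝒫_1` below 4000, `ν(n) ≤ 3`, in PARI's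
  period normalisation (a `p`-unit away from the tree's `Ω⁺_f` when `E[p]` is irreducible):
  ```
  curve  r w   p  𝒫_1 (first six)               δ_1    ν=1 (six δ_ℓ)        ν=2 (six δ_{ℓℓ'})      ν=3 (one)
  11a1   0 +1  7  113,379,701,1051,2437,2521    ≠0 ✓   all 0      V1 ✓      0,5,0,4,2,6 (free)     0   V1 ✓
  37a1   1 −1  5  61,211,281,491,521,571        0 V0   1,0,1,2,1,2  K ✓     all 0        V1 ✓      1  (free)
  37a1   1 −1  7  43,71,701,1009,1723,1933      0 V0   4,1,6,1,6,6  K ✓     all 0        V1 ✓      5  (free)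
  389a1  2 +1  5  41,61,131,211,251,271         0 V0   all 0      V1 ✓      4,1,2,2,4,0    K ✓     0   V1 ✓
  389a1  2 +1  7  113,281,673,1429,2423,3389    0 V0   all 0      V1 ✓      0,2,1,0,0,2    K ✓     0   V1 ✓
  5077a1 3 −1  5  71,401,631,641,691,761        0 V0   all 0      V2a ✓     all 0        V1 ✓      3   K ✓
  5077a1 3 −1  7  113,211,463,547,673,743       0 V0   all 0      V2a ✓     all 0        V1 ✓      6   K ✓
  ```
  63/63 stub predictions consistent on the admissible pairs (V0 ×6, V1 ×45, V2a ×12 — the twelve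
  `δ_ℓ ≡ 0` of 5077a1 are the "Selmer-only" odd layer V2a asserts), 0 violations; K-witnesses
  (`δ_n ≢ 0` with `ν(n) = rank`) found for every curve at both primes, including `ν = 3` for 5077a1
  (`δ_{71·401·631} ≡ 3 mod 5`, `δ_{113·211·463} ≡ 6 mod 7`), as Kim's `ord(δ̃) = corank` predicts. The
  389a1 values are the on-paper witnesses that V2b WITHOUT its threshold `ν < r_an` is false (§(D),
  `analyticRank_le_one_of_noUpper`): `n = 2501 = 41·61 ∈ 𝒩_1(389a1, 5)`, `ν = 2 = r_an`, even
  parity, `δ_n ≡ 4 (mod 5)`.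
  CONTROL at an excluded pair — (11a1, p = 5): good ordinary (a_5 = 1) but `ρ̄_{E,5}` REDUCIBLE
  (rational 5-torsion), `[0]⁺ = 1/5` not 5-integral: the genuine wrong-parity numbers do NOT vanish —
  `δ_31 ≡ 2, δ_41 ≡ 1, δ_61 ≡ 4, δ_71 ≡ 3, δ_131 ≡ 2 (mod 5)` (`ν = 1`, `r_an = 0`). So the image /
  irreducibility hypothesis of V1 is LOAD-BEARING ON PAPER: the Mazur–Tate functional equation alone
  does not force vanishing, the `p`-INTEGRALITY of the symbols (`IsNewformOf.norm_ratPlusSymbol_le_one`,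
  from `E[p]` irreducible) does the work in the correction terms `(a_ℓ − 2)[b/d]⁺ ≡ 0`. (In the tree's
  `ratModP` arithmetic every symbol of 11a1 has `5 ∣ den`, so `kuriharaNumber` is junk `0` there and no
  Lean `_false_without_surjectivity` lemma for V1 comes out of this pair either.)

## What resists and why (for the provers)
The crux is the `r_an ≥ 4` lower bound `r_an ≤ corank_p`; modulo `p`-parity and the corank-0/1
converses its first open instance is the rank-2 `p`-converse. Every disproof strategy needs a curve
with CERTIFIED `r_an ≥ 2` (none exists in Lean outside CM rank-1 phenomena) together with a Selmer
corank computation falling short of it — which would refute BSD itself (A). The disprover's standing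
advice: do not spend effort on side conditions of the crux (they are provability scaffolding), and on
the line `kurihara_order` attack V2b only through BSD-compatible mechanisms — (D) shows V2b inherits
the crux's immunity.
-/

set_option linter.dupNamespace false

noncomputable section

open scoped MatrixGroups ModularForm

open CongruenceSubgroup Literature.NumberTheory.EllipticCurves
  Literature.NumberTheory.EllipticCurves.ModularForms

namespace Summit.BirchSwinnertonDyer.BirchSwinnertonDyer.Cruxes.SelmerRankLB.Disproof

open Summit.BirchSwinnertonDyer.BirchSwinnertonDyer.Theses

/-! ## (A) Load-bearing analysis: the crux with EVERY hypothesis dropped is still BSD-implied -/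

/-- `SelmerRankLB` with all five hypotheses (`IsGloballyMinimal`, `5 ≤ p`, good, ordinary,
surjective image) dropped: `r_an(W) ≤ corank_{ℤ_p} Sel_{p^∞}(W/ℚ)` for every elliptic `W/ℚ` and
every prime `p`. [folklore] -/
def SelmerRankLBNaked : Prop :=
  ∀ (W : WeierstrassCurve ℚ) [W.IsElliptic] (p : ℕ) [Fact p.Prime], W.analyticRank ≤ W.selmerCorank p

/-- The naked statement implies the crux (trivially: it has fewer hypotheses). Stated with the
crux NEGATED on both sides so that no declaration concludes a route decl positively. [folklore] -/
theorem not_naked_of_not_selmerRankLB (h : ¬ TangentCone.SelmerRankLB) : ¬ SelmerRankLBNaked :=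
  fun hN ↦ h fun W _ _ p _ _ _ _ _ ↦ hN W p

/-- **The naked crux follows from the summit** (`r_an = rank ≤ rank + corank Ш[p^∞] = corank Sel`),
by the PROVED tree identity `WeierstrassCurve.selmerCorank_eq_mordellWeilRank_add_holds`
(Greenberg 1999 §1). So none of the five hypotheses is needed for truth, given BSD. [folklore] -/
theorem naked_of_summit (h : _root_.BirchSwinnertonDyer) : SelmerRankLBNaked := by
  intro W _ p _
  have h1 : W.analyticRank = W.mordellWeilRank := h W inferInstance
  have h2 : W.selmerCorank p = W.mordellWeilRank + W.shaCorank p :=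
    W.selmerCorank_eq_mordellWeilRank_add_holds p
  omega

/-- **Any counterexample to the naked crux refutes the Lean summit.** [folklore] -/
theorem not_summit_of_not_naked (h : ¬ SelmerRankLBNaked) : ¬ _root_.BirchSwinnertonDyer :=
  fun hS ↦ h (naked_of_summit hS)

/-- **Any counterexample to the crux `SelmerRankLB` refutes the Lean summit** — the crux cannot be
"misstated-false": no `_false_without_<H>` lemma is available for any of its hypotheses unless
`¬ BirchSwinnertonDyer` is a theorem. [folklore] -/
theorem not_summit_of_not_selmerRankLB (h : ¬ TangentCone.SelmerRankLB) :
    ¬ _root_.BirchSwinnertonDyer :=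
  not_summit_of_not_naked (not_naked_of_not_selmerRankLB h)

/-- The same for the item's original route copy (the decl the picked skeleton concludes). [folklore] -/
theorem not_summit_of_not_selmerRankLB' (h : ¬ SelmerRank.SelmerRankLB) :
    ¬ _root_.BirchSwinnertonDyer :=
  fun hS ↦ h fun W _ _ p _ _ _ _ _ ↦ naked_of_summit hS W p

/-! ## (B) The only in-tree curves with provably positive analytic rank are CM (excluded by `ρ̄` onto) -/

/-- **Non-triviality of the conclusion is witnessed in tree only by CM curves.** For square-free
`n ≡ 5, 7 (mod 8)` the congruent-number curve `E_n` is elliptic, globally minimal, has good reduction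
at every `p ∤ 2n`, and has `r_an(E_n) ≥ 1` — all PROVED in tree (Hecke continuation of `L(E_n,s)` and
the root number `−1`). These are the only Weierstrass curves over `ℚ` for which the tree can bound
`analyticRank` from below today, and every one of them has CM by `ℤ[i]`, hence a non-surjective
mod-`p` image for all odd `p` (normaliser of a Cartan) — excluded by the crux's last hypothesis
(on paper; the tree has no image computation). [cite: TopYui2008Congruent, §3, p. 618] -/
theorem cm_instances_with_positive_analyticRank {n : ℕ} (hsq : Squarefree n)
    (h8 : n % 8 = 5 ∨ n % 8 = 7) {p : ℕ} [Fact p.Prime] (hp : ¬ p ∣ 2 * n) :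
    (congruentNumberCurve n).IsElliptic ∧ (congruentNumberCurve n).IsGloballyMinimal ∧
      (congruentNumberCurve n).HasGoodReductionAtPrime p ∧
      1 ≤ (congruentNumberCurve n).analyticRank :=
  ⟨isElliptic_congruentNumberCurve hsq.ne_zero, isGloballyMinimal_congruentNumberCurve hsq,
    hasGoodReductionAtPrime_congruentNumberCurve hp,
    Nat.one_le_iff_ne_zero.mpr (analyticRank_congruentNumberCurve_ne_zero hsq h8)⟩

/-- On that family the naked crux reads `1 ≤ corank_p Sel_{p^∞}(E_n/ℚ)` as soon as `r_an(E_n) ≤ 1`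
(the expected value); i.e. it is the infinitude of `Sel_{p^∞}(E_n/ℚ)`, which follows from
`rank E_n(ℚ) ≥ 1` (`n` a congruent number) by the proved corank identity — recorded as the
implication actually available in tree. [folklore] -/
theorem naked_instance_of_rank_pos (W : WeierstrassCurve ℚ) [W.IsElliptic] (p : ℕ) [Fact p.Prime]
    (hr : 1 ≤ W.mordellWeilRank) (h1 : W.analyticRank ≤ 1) : W.analyticRank ≤ W.selmerCorank p := by
  have h2 : W.selmerCorank p = W.mordellWeilRank + W.shaCorank p :=
    W.selmerCorank_eq_mordellWeilRank_add_holds p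
  omega

/-! ## (D) Targets: the stubs of line `kurihara_order` (skeleton f1ba77bd…)

The statements below are VERBATIM the stub signatures registered on the item (ledger `stubs[]`,
2026-08-17T06:42:03Z), so that each `Stub…` is syntactically the corresponding
`KuriharaOrder.Statement.stub_…` of `Lines/kurihara_order.lean`. -/

/-- Stub V0 `stub_delta_one`, verbatim. [folklore] -/
def StubDeltaOne : Prop :=
  ∀ (W : WeierstrassCurve ℚ) [W.IsElliptic] [W.IsGloballyMinimal] (p : ℕ) [Fact p.Prime]
    (_ : NeZero (W.conductorNorm ℤ)) (f : CuspForm (Gamma0 (W.conductorNorm ℤ)) 2),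
    IsNewformOf W f → 1 ≤ W.analyticRank →
    ∀ (k : ℕ) (ψ : (ℓ : ℕ) → (ZMod ℓ)ˣ →* Multiplicative (ZMod (p ^ k))),
      kuriharaNumber f (p ^ k) 1 ψ = 0

/-- Stub V1 `stub_delta_parity`, verbatim. [folklore] -/
def StubDeltaParity : Prop :=
  ∀ (W : WeierstrassCurve ℚ) [W.IsElliptic] [W.IsGloballyMinimal] (p : ℕ) [Fact p.Prime],
    5 ≤ p → W.HasGoodReductionAtPrime p → ¬ (p : ℤ) ∣ W.frobeniusTrace p →
    W.HasSurjectiveModNGaloisRep p →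
    ∀ (_ : NeZero (W.conductorNorm ℤ)) (f : CuspForm (Gamma0 (W.conductorNorm ℤ)) 2),
      IsNewformOf W f →
      ∀ (k n : ℕ) [NeZero n], 1 ≤ k → Kato.IsKolyvaginProduct W p k n →
        ¬ Even (n.primeFactors.card + W.analyticRank) →
        ∀ ψ : (ℓ : ℕ) → (ZMod ℓ)ˣ →* Multiplicative (ZMod (p ^ k)),
          (∀ ℓ ∈ n.primeFactors, Function.Surjective (ψ ℓ)) →
          kuriharaNumber f (p ^ k) n ψ = 0

/-- Stub V2a `stub_delta_prime_of_odd_rank`, verbatim. [folklore] -/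
def StubDeltaPrimeOfOddRank : Prop :=
  ∀ (W : WeierstrassCurve ℚ) [W.IsElliptic] [W.IsGloballyMinimal] (p : ℕ) [Fact p.Prime],
    5 ≤ p → W.HasGoodReductionAtPrime p → ¬ (p : ℤ) ∣ W.frobeniusTrace p →
    W.HasSurjectiveModNGaloisRep p →
    ∀ (_ : NeZero (W.conductorNorm ℤ)) (f : CuspForm (Gamma0 (W.conductorNorm ℤ)) 2),
      IsNewformOf W f →
      ∀ (k n : ℕ) [NeZero n], 1 ≤ k → Kato.IsKolyvaginProduct W p k n → n.primeFactors.card = 1 →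
        Odd W.analyticRank → 3 ≤ W.analyticRank →
        ∀ ψ : (ℓ : ℕ) → (ZMod ℓ)ˣ →* Multiplicative (ZMod (p ^ k)),
          (∀ ℓ ∈ n.primeFactors, Function.Surjective (ψ ℓ)) →
          kuriharaNumber f (p ^ k) n ψ = 0

/-- Stub V2b `stub_delta_evenGap` (the OPEN core), verbatim. [folklore] -/
def StubDeltaEvenGap : Prop :=
  ∀ (W : WeierstrassCurve ℚ) [W.IsElliptic] [W.IsGloballyMinimal] (p : ℕ) [Fact p.Prime],
    5 ≤ p → W.HasGoodReductionAtPrime p → ¬ (p : ℤ) ∣ W.frobeniusTrace p →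
    W.HasSurjectiveModNGaloisRep p →
    ∀ (_ : NeZero (W.conductorNorm ℤ)) (f : CuspForm (Gamma0 (W.conductorNorm ℤ)) 2),
      IsNewformOf W f →
      ∀ (k n : ℕ) [NeZero n], 1 ≤ k → Kato.IsKolyvaginProduct W p k n → 2 ≤ n.primeFactors.card →
        Even (n.primeFactors.card + W.analyticRank) →
        n.primeFactors.card < W.analyticRank →
        ∀ ψ : (ℓ : ℕ) → (ZMod ℓ)ˣ →* Multiplicative (ZMod (p ^ k)),
          (∀ ℓ ∈ n.primeFactors, Function.Surjective (ψ ℓ)) →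
          kuriharaNumber f (p ^ k) n ψ = 0

/-- Stub K `stub_kim_order_le_corank`, verbatim. [folklore] -/
def StubKimOrderLeCorank : Prop :=
  ∀ (W : WeierstrassCurve ℚ) [W.IsElliptic] [W.IsGloballyMinimal] (p : ℕ) [Fact p.Prime],
    5 ≤ p → W.HasGoodReductionAtPrime p → ¬ (p : ℤ) ∣ W.frobeniusTrace p →
    W.HasSurjectiveModNGaloisRep p →
    ∃ (_ : NeZero (W.conductorNorm ℤ)) (f : CuspForm (Gamma0 (W.conductorNorm ℤ)) 2),
      IsNewformOf W f ∧
      ∃ (k n : ℕ) (_ : NeZero n), 1 ≤ k ∧ Kato.IsKolyvaginProduct W p k n ∧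
        n.primeFactors.card ≤ W.selmerCorank p ∧
        ∃ ψ : (ℓ : ℕ) → (ZMod ℓ)ˣ →* Multiplicative (ZMod (p ^ k)),
          (∀ ℓ ∈ n.primeFactors, Function.Surjective (ψ ℓ)) ∧
          kuriharaNumber f (p ^ k) n ψ ≠ 0

/-- **(KV) with every side condition dropped**: at the crux's primes, every Kurihara number
`δ_n^{(k)}` (`k ≥ 1`, `n ∈ 𝒩_k`) with `ν(n) < r_an` vanishes — the union of V0 (n = 1), V1 (wrong
parity), V2a (`ν = 1`, `r_an` odd `≥ 3`) and V2b (`2 ≤ ν < r_an`, right parity), i.e. the statement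
the skeleton's `kuriharaNumber_eq_zero_of_lt_analyticRank` assembles from the four V-stubs. [folklore] -/
def StubKV : Prop :=
  ∀ (W : WeierstrassCurve ℚ) [W.IsElliptic] [W.IsGloballyMinimal] (p : ℕ) [Fact p.Prime],
    5 ≤ p → W.HasGoodReductionAtPrime p → ¬ (p : ℤ) ∣ W.frobeniusTrace p →
    W.HasSurjectiveModNGaloisRep p →
    ∀ (_ : NeZero (W.conductorNorm ℤ)) (f : CuspForm (Gamma0 (W.conductorNorm ℤ)) 2),
      IsNewformOf W f →
      ∀ (k n : ℕ) [NeZero n], 1 ≤ k → Kato.IsKolyvaginProduct W p k n →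
        n.primeFactors.card < W.analyticRank →
        ∀ ψ : (ℓ : ℕ) → (ZMod ℓ)ˣ →* Multiplicative (ZMod (p ^ k)),
          (∀ ℓ ∈ n.primeFactors, Function.Surjective (ψ ℓ)) →
          kuriharaNumber f (p ^ k) n ψ = 0

/-- **Kim's theorem, non-vanishing ⇒ corank bound (a THEOREM in print, typed in tree vocabulary).**
For `E/ℚ` (globally minimal `W`), `p ≥ 5` good ordinary with `ρ̄_{E,p}` surjective, the newform `f`
of `W`, `k ≥ 1`, `n ∈ 𝒩_k` and surjective discrete logarithms: if `δ_n^{(k)} ≠ 0` in `ℤ/p^k` then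
`corank_{ℤ_p} Sel_{p^∞}(E/ℚ) ≤ ν(n)`. This is the consequence `δ̃_n ≠ 0 ⇒ ord(δ̃) ≤ ν(n)` of
`corank = ord(δ̃) = min{ν(n) : δ̃_n ≠ 0}` (Kim 2022, Thm. 1.9 (1), with Cor. 1.14
"`δ̃_n ≠ 0 ⇒ rank E(ℚ) ≤ corank ≤ ν(n)`"); the passage from `δ_n^{(k)} ≠ 0 (mod p^k)` to
`δ̃_n ≠ 0 (mod I_n)` uses `I_n ⊆ p^kℤ_p` for `n ∈ 𝒩_k`, and the tree's period `Ω⁺_f` differs from the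
Néron period by a `p`-adic unit under these hypotheses. Stated here as a hypothesis `Prop` (it is
the natural companion of stub K, the opposite half of the same theorem); not asserted.
[cite: Kim2022StructureSelmer, Thm. 1.9 (1) and Cor. 1.14] -/
def KimCorankLeOfNonvanishing : Prop :=
  ∀ (W : WeierstrassCurve ℚ) [W.IsElliptic] [W.IsGloballyMinimal] (p : ℕ) [Fact p.Prime],
    5 ≤ p → W.HasGoodReductionAtPrime p → ¬ (p : ℤ) ∣ W.frobeniusTrace p →
    W.HasSurjectiveModNGaloisRep p →
    ∀ (_ : NeZero (W.conductorNorm ℤ)) (f : CuspForm (Gamma0 (W.conductorNorm ℤ)) 2),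
      IsNewformOf W f →
      ∀ (k n : ℕ) [NeZero n], 1 ≤ k → Kato.IsKolyvaginProduct W p k n →
        ∀ ψ : (ℓ : ℕ) → (ZMod ℓ)ˣ →* Multiplicative (ZMod (p ^ k)),
          (∀ ℓ ∈ n.primeFactors, Function.Surjective (ψ ℓ)) →
          kuriharaNumber f (p ^ k) n ψ ≠ 0 → W.selmerCorank p ≤ n.primeFactors.card

/-- **(KV) — hence every V-stub, in particular the open V2b — follows from the summit and Kim's
theorem**: if `δ_n^{(k)} ≠ 0` then `corank ≤ ν(n) < r_an = rank ≤ corank` (BSD + the proved corank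
identity), absurd. So V2b cannot be false unless the Lean summit `BirchSwinnertonDyer` or Kim 2022
Thm. 1.9 (1) is: the open stub inherits the crux's immunity to refutation, and its three side
conditions (`2 ≤ ν`, parity, `hψ`) play no role in that. [folklore] -/
theorem stubKV_of_summit_of_kim (hS : _root_.BirchSwinnertonDyer) (hKim : KimCorankLeOfNonvanishing) :
    StubKV := by
  intro W _ _ p _ h5 hgood hord hsurj hN f hf k n _ hk hn hν ψ hψ
  by_contra hne
  have hcor : W.selmerCorank p ≤ n.primeFactors.card :=
    hKim W p h5 hgood hord hsurj hN f hf k n hk hn ψ hψ hne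
  have h1 : W.analyticRank = W.mordellWeilRank := hS W inferInstance
  have h2 : W.selmerCorank p = W.mordellWeilRank + W.shaCorank p :=
    W.selmerCorank_eq_mordellWeilRank_add_holds p
  omega

/-- V2b is a special case of (KV). [folklore] -/
theorem stubDeltaEvenGap_of_stubKV (h : StubKV) : StubDeltaEvenGap :=
  fun W _ _ p _ h5 hgood hord hsurj hN f hf k n _ hk hn _ _ hν ψ hψ ↦
    h W p h5 hgood hord hsurj hN f hf k n hk hn hν ψ hψ

/-- V1 restricted to `ν(n) < r_an` is a special case of (KV) (the part of V1 the composition uses).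
[folklore] -/
theorem stubDeltaParity_lt_of_stubKV (h : StubKV) :
    ∀ (W : WeierstrassCurve ℚ) [W.IsElliptic] [W.IsGloballyMinimal] (p : ℕ) [Fact p.Prime],
      5 ≤ p → W.HasGoodReductionAtPrime p → ¬ (p : ℤ) ∣ W.frobeniusTrace p →
      W.HasSurjectiveModNGaloisRep p →
      ∀ (_ : NeZero (W.conductorNorm ℤ)) (f : CuspForm (Gamma0 (W.conductorNorm ℤ)) 2),
        IsNewformOf W f →
        ∀ (k n : ℕ) [NeZero n], 1 ≤ k → Kato.IsKolyvaginProduct W p k n →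
          n.primeFactors.card < W.analyticRank →
          ¬ Even (n.primeFactors.card + W.analyticRank) →
          ∀ ψ : (ℓ : ℕ) → (ZMod ℓ)ˣ →* Multiplicative (ZMod (p ^ k)),
            (∀ ℓ ∈ n.primeFactors, Function.Surjective (ψ ℓ)) →
            kuriharaNumber f (p ^ k) n ψ = 0 :=
  fun W _ _ p _ h5 hgood hord hsurj hN f hf k n _ hk hn hν _ ψ hψ ↦
    h W p h5 hgood hord hsurj hN f hf k n hk hn hν ψ hψ

/-- V2a is a special case of (KV) (`ν(n) = 1 < 3 ≤ r_an`). [folklore] -/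
theorem stubDeltaPrimeOfOddRank_of_stubKV (h : StubKV) : StubDeltaPrimeOfOddRank :=
  fun W _ _ p _ h5 hgood hord hsurj hN f hf k n _ hk hn h1 _ h3 ψ hψ ↦
    h W p h5 hgood hord hsurj hN f hf k n hk hn (by omega) ψ hψ

/-- **The open stub V2b is refutation-proof relative to {summit, Kim Thm 1.9 (1)}**: a disproof of
`StubDeltaEvenGap` is a disproof of `BirchSwinnertonDyer ∧ KimCorankLeOfNonvanishing`. [folklore] -/
theorem not_summit_or_not_kim_of_not_stubDeltaEvenGap (h : ¬ StubDeltaEvenGap) :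
    ¬ _root_.BirchSwinnertonDyer ∨ ¬ KimCorankLeOfNonvanishing := by
  by_contra h'
  push Not at h'
  exact h (stubDeltaEvenGap_of_stubKV (stubKV_of_summit_of_kim h'.1 h'.2))

/-! ### Mutation: the surjectivity of the discrete logarithms is decoration in the V-stubs -/

/-- **Any discrete logarithm is a multiple of a surjective one.** For a prime `ℓ` and homomorphisms
`ψ₀, ψ : (ℤ/ℓ)ˣ → ℤ/m` with `ψ₀` surjective, `ψ = c · ψ₀` for some `c ∈ ℤ/m` (`(ℤ/ℓ)ˣ` is cyclic,
`ψ₀` maps a generator to a unit). Variant of the tree's `exists_units_forall_toAdd_eq_mul` without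
surjectivity of `ψ` (then `c` need not be a unit). [folklore] -/
theorem exists_forall_toAdd_eq_mul_of_surjective {ℓ : ℕ} (hℓ : ℓ.Prime) {m : ℕ}
    (ψ₀ ψ : (ZMod ℓ)ˣ →* Multiplicative (ZMod m)) (h₀ : Function.Surjective ψ₀) :
    ∃ c : ZMod m, ∀ x, Multiplicative.toAdd (ψ x) = c * Multiplicative.toAdd (ψ₀ x) := by
  haveI : IsCyclic (ZMod ℓ)ˣ := ZMod.isCyclic_units_prime hℓ
  obtain ⟨g, hg⟩ := IsCyclic.exists_generator (α := (ZMod ℓ)ˣ)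
  -- `ψ₀ g` is a unit of `ℤ/m`
  have key : IsUnit (Multiplicative.toAdd (ψ₀ g)) := by
    obtain ⟨y, hy⟩ := h₀ (Multiplicative.ofAdd 1)
    obtain ⟨k, rfl⟩ := Subgroup.mem_zpowers_iff.mp (hg y)
    rw [map_zpow] at hy
    have hk : (k : ZMod m) * Multiplicative.toAdd (ψ₀ g) = 1 := by
      rw [← zsmul_eq_mul, ← toAdd_zpow, hy]
      rfl
    exact IsUnit.of_mul_eq_one_right (k : ZMod m) hk
  obtain ⟨u, hu⟩ := key
  refine ⟨Multiplicative.toAdd (ψ g) * (u⁻¹ : (ZMod m)ˣ), fun x ↦ ?_⟩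
  obtain ⟨k, rfl⟩ := Subgroup.mem_zpowers_iff.mp (hg x)
  rw [map_zpow ψ, map_zpow ψ₀, toAdd_zpow, toAdd_zpow, ← hu, zsmul_eq_mul, zsmul_eq_mul,
    mul_comm (k : ZMod m) (u : ZMod m), ← mul_assoc, Units.inv_mul_cancel_right, mul_comm]

/-- **Vanishing for all surjective logarithms ⇒ vanishing for all logarithms** at a level `n` whose
prime factors `ℓ` all satisfy `m ∣ ℓ - 1` (so that surjective logarithms exist,
`exists_surjective_unitsHom`); every `n ∈ 𝒩_k` qualifies for `m = p^k` (`ℓ ≡ 1 (mod p^k)`). Hence the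
hypothesis `hψ : ∀ ℓ ∈ n.primeFactors, Surjective (ψ ℓ)` of stubs V0/V1/V2a/V2b is DECORATION: each
V-stub is equivalent to its `hψ`-free form. [folklore] -/
theorem kuriharaNumber_eq_zero_of_forall_surjective {N : ℕ} (f : CuspForm (Gamma0 N) 2)
    (m n : ℕ) [NeZero n] (hdiv : ∀ ℓ ∈ n.primeFactors, m ∣ ℓ - 1)
    (h : ∀ ψ : (ℓ : ℕ) → (ZMod ℓ)ˣ →* Multiplicative (ZMod m),
      (∀ ℓ ∈ n.primeFactors, Function.Surjective (ψ ℓ)) → kuriharaNumber f m n ψ = 0)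
    (ψ : (ℓ : ℕ) → (ZMod ℓ)ˣ →* Multiplicative (ZMod m)) : kuriharaNumber f m n ψ = 0 := by
  classical
  -- a surjective logarithm at every prime factor of `n`
  have hex : ∀ ℓ ∈ n.primeFactors, ∃ ψ₀ : (ZMod ℓ)ˣ →* Multiplicative (ZMod m),
      Function.Surjective ψ₀ := fun ℓ hℓ ↦
    exists_surjective_unitsHom (Nat.prime_of_mem_primeFactors hℓ) (hdiv ℓ hℓ)
  choose! ψ₀ hψ₀ using hex
  -- `ψ ℓ = c ℓ • ψ₀ ℓ` at every prime factor
  have hc : ∀ ℓ ∈ n.primeFactors, ∃ c : ZMod m, ∀ x : (ZMod ℓ)ˣ,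
      Multiplicative.toAdd (ψ ℓ x) = c * Multiplicative.toAdd (ψ₀ ℓ x) := fun ℓ hℓ ↦
    exists_forall_toAdd_eq_mul_of_surjective (Nat.prime_of_mem_primeFactors hℓ) (ψ₀ ℓ) (ψ ℓ)
      (hψ₀ ℓ hℓ)
  choose! c hc using hc
  rw [kuriharaNumber_eq_prod_mul_kuriharaNumber f m n c hc, h ψ₀ hψ₀, mul_zero]

/-- Conversely for stub K: **a non-vanishing Kurihara number for SOME logarithm gives one for a
SURJECTIVE logarithm** (same hypothesis on `n`). So K's `∃ ψ surjective, δ ≠ 0` ⟺ `∃ ψ, δ ≠ 0`.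
[folklore] -/
theorem exists_surjective_ne_zero_of_ne_zero {N : ℕ} (f : CuspForm (Gamma0 N) 2)
    (m n : ℕ) [NeZero n] (hdiv : ∀ ℓ ∈ n.primeFactors, m ∣ ℓ - 1)
    {ψ : (ℓ : ℕ) → (ZMod ℓ)ˣ →* Multiplicative (ZMod m)} (hne : kuriharaNumber f m n ψ ≠ 0) :
    ∃ ψ₀ : (ℓ : ℕ) → (ZMod ℓ)ˣ →* Multiplicative (ZMod m),
      (∀ ℓ ∈ n.primeFactors, Function.Surjective (ψ₀ ℓ)) ∧ kuriharaNumber f m n ψ₀ ≠ 0 := by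
  by_contra hall
  push Not at hall
  exact hne (kuriharaNumber_eq_zero_of_forall_surjective f m n hdiv
    (fun ψ₀ h₀ ↦ hall ψ₀ h₀) ψ)

/-- The divisibility side condition holds at every `n ∈ 𝒩_k` with `m = p^k`: a Kolyvagin prime of
level `k` is `≡ 1 (mod p^k)`. [folklore] -/
theorem pow_dvd_sub_one_of_isKolyvaginProduct {W : WeierstrassCurve ℚ} [W.IsGloballyMinimal]
    {p k n : ℕ} (hn : Kato.IsKolyvaginProduct W p k n) :
    ∀ ℓ ∈ n.primeFactors, p ^ k ∣ ℓ - 1 := by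
  intro ℓ hℓ
  have h1 : ℓ ≡ 1 [MOD p ^ k] := (hn.2 ℓ hℓ).2.2.1
  exact (Nat.modEq_iff_dvd' (Nat.prime_of_mem_primeFactors hℓ).one_lt.le).mp h1.symm

/-- **V2b ⟺ V2b without `hψ`.** The `hψ`-free form (vanishing for every choice of logarithms).
[folklore] -/
def StubDeltaEvenGapAllLogs : Prop :=
  ∀ (W : WeierstrassCurve ℚ) [W.IsElliptic] [W.IsGloballyMinimal] (p : ℕ) [Fact p.Prime],
    5 ≤ p → W.HasGoodReductionAtPrime p → ¬ (p : ℤ) ∣ W.frobeniusTrace p →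
    W.HasSurjectiveModNGaloisRep p →
    ∀ (_ : NeZero (W.conductorNorm ℤ)) (f : CuspForm (Gamma0 (W.conductorNorm ℤ)) 2),
      IsNewformOf W f →
      ∀ (k n : ℕ) [NeZero n], 1 ≤ k → Kato.IsKolyvaginProduct W p k n → 2 ≤ n.primeFactors.card →
        Even (n.primeFactors.card + W.analyticRank) →
        n.primeFactors.card < W.analyticRank →
        ∀ ψ : (ℓ : ℕ) → (ZMod ℓ)ˣ →* Multiplicative (ZMod (p ^ k)),
          kuriharaNumber f (p ^ k) n ψ = 0

/-- The two forms of V2b are equivalent (surjectivity of `ψ` is decoration). [folklore] -/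
theorem stubDeltaEvenGap_iff_allLogs : StubDeltaEvenGap ↔ StubDeltaEvenGapAllLogs := by
  constructor
  · intro h W _ _ p _ h5 hgood hord hsurj hN f hf k n _ hk hn h2 he hν ψ
    exact kuriharaNumber_eq_zero_of_forall_surjective f (p ^ k) n
      (pow_dvd_sub_one_of_isKolyvaginProduct hn)
      (fun ψ' hψ' ↦ h W p h5 hgood hord hsurj hN f hf k n hk hn h2 he hν ψ' hψ') ψ
  · intro h W _ _ p _ h5 hgood hord hsurj hN f hf k n _ hk hn h2 he hν ψ _
    exact h W p h5 hgood hord hsurj hN f hf k n hk hn h2 he hν ψ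

/-! ### Mutation: the level bound `1 ≤ k` is decoration in the V-stubs (modulus `p^0 = 1`) -/

/-- At level `k = 0` every Kurihara number vanishes (`ℤ/p^0 = ℤ/1` is the zero ring), so the
hypothesis `1 ≤ k` of V1/V2a/V2b is decoration (and V0 rightly omits it). [folklore] -/
theorem kuriharaNumber_level_zero {N : ℕ} (f : CuspForm (Gamma0 N) 2) (p n : ℕ) [NeZero n]
    (ψ : (ℓ : ℕ) → (ZMod ℓ)ˣ →* Multiplicative (ZMod (p ^ 0))) : kuriharaNumber f (p ^ 0) n ψ = 0 := by
  haveI : Subsingleton (ZMod (p ^ 0)) := by rw [pow_zero]; exact ZMod.subsingleton_iff.mpr rfl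
  exact Subsingleton.elim _ _

/-- V2b without the level bound `1 ≤ k`. [folklore] -/
def StubDeltaEvenGapAnyLevel : Prop :=
  ∀ (W : WeierstrassCurve ℚ) [W.IsElliptic] [W.IsGloballyMinimal] (p : ℕ) [Fact p.Prime],
    5 ≤ p → W.HasGoodReductionAtPrime p → ¬ (p : ℤ) ∣ W.frobeniusTrace p →
    W.HasSurjectiveModNGaloisRep p →
    ∀ (_ : NeZero (W.conductorNorm ℤ)) (f : CuspForm (Gamma0 (W.conductorNorm ℤ)) 2),
      IsNewformOf W f →
      ∀ (k n : ℕ) [NeZero n], Kato.IsKolyvaginProduct W p k n → 2 ≤ n.primeFactors.card →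
        Even (n.primeFactors.card + W.analyticRank) →
        n.primeFactors.card < W.analyticRank →
        ∀ ψ : (ℓ : ℕ) → (ZMod ℓ)ˣ →* Multiplicative (ZMod (p ^ k)),
          (∀ ℓ ∈ n.primeFactors, Function.Surjective (ψ ℓ)) →
          kuriharaNumber f (p ^ k) n ψ = 0

/-- `1 ≤ k` is decoration: V2b ⟺ V2b at every level `k ≥ 0`. [folklore] -/
theorem stubDeltaEvenGap_iff_anyLevel : StubDeltaEvenGap ↔ StubDeltaEvenGapAnyLevel := by
  constructor
  · intro h W _ _ p _ h5 hgood hord hsurj hN f hf k n _ hn h2 he hν ψ hψ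
    rcases Nat.eq_zero_or_pos k with rfl | hk
    · exact kuriharaNumber_level_zero f p n ψ
    · exact h W p h5 hgood hord hsurj hN f hf k n hk hn h2 he hν ψ hψ
  · intro h W _ _ p _ h5 hgood hord hsurj hN f hf k n _ _ hn h2 he hν ψ hψ
    exact h W p h5 hgood hord hsurj hN f hf k n hn h2 he hν ψ hψ

/-! ### Load-bearing analysis of V2b's OWN side conditions

V2b carries, beyond the crux's hypotheses, `1 ≤ k` (decoration, above), `hψ` (decoration, above),
`2 ≤ ν(n)`, `Even (ν(n) + r_an)` and `ν(n) < r_an`.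
* Dropping `2 ≤ ν(n)` adds the cases `ν = 0` (then `r_an` even `≥ 1`, i.e. `n = 1`, V0's content) and
  `ν = 1` (then `r_an` odd `> 1`, i.e. `≥ 3`, V2a's content): both TRUE in print — not load-bearing
  for truth (it only isolates the open part).
* Dropping `Even (ν(n) + r_an)` adds the wrong-parity levels with `2 ≤ ν < r_an`: V1's content, TRUE
  in print — not load-bearing for truth.
* Dropping `ν(n) < r_an` is FATAL: together with K, V0, V1, V2a it proves that EVERY curve in the
  crux's range has analytic rank ≤ 1 (`analyticRank_le_one_of_noUpper` below) — false on paper at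
  (389a1, p = 5): r_an = 2, a_5 = −3, ρ̄ onto (no isogeny, semistable), where indeed
  `δ_{41·61} ≡ 4 (mod 5)` (PARI job j023832, §(F); 41, 61 ∈ 𝒫_1: a_41 ≡ 42, a_61 ≡ 62 mod 5). Not a Lean
  refutation (no certified `r_an = 2` curve in tree), but the load-bearing hypothesis is identified:
  the whole content of V2b is the THRESHOLD `r_an`, nothing else. -/

/-- V2b with the threshold `ν(n) < r_an` DROPPED (the fatal mutation). [folklore] -/
def StubDeltaEvenGapNoUpper : Prop :=
  ∀ (W : WeierstrassCurve ℚ) [W.IsElliptic] [W.IsGloballyMinimal] (p : ℕ) [Fact p.Prime],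
    5 ≤ p → W.HasGoodReductionAtPrime p → ¬ (p : ℤ) ∣ W.frobeniusTrace p →
    W.HasSurjectiveModNGaloisRep p →
    ∀ (_ : NeZero (W.conductorNorm ℤ)) (f : CuspForm (Gamma0 (W.conductorNorm ℤ)) 2),
      IsNewformOf W f →
      ∀ (k n : ℕ) [NeZero n], 1 ≤ k → Kato.IsKolyvaginProduct W p k n → 2 ≤ n.primeFactors.card →
        Even (n.primeFactors.card + W.analyticRank) →
        ∀ ψ : (ℓ : ℕ) → (ZMod ℓ)ˣ →* Multiplicative (ZMod (p ^ k)),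
          (∀ ℓ ∈ n.primeFactors, Function.Surjective (ψ ℓ)) →
          kuriharaNumber f (p ^ k) n ψ = 0

/-- A non-zero natural number other than `1` has a prime factor. [folklore] -/
theorem one_le_card_primeFactors {n : ℕ} (h0 : n ≠ 0) (h1 : n ≠ 1) : 1 ≤ n.primeFactors.card := by
  rw [Nat.one_le_iff_ne_zero, Ne, Finset.card_eq_zero, Nat.primeFactors_eq_empty]
  omega

/-- **`ν(n) < r_an` is THE load-bearing hypothesis of V2b.** With the threshold dropped, the stubs
K, V0, V1, V2a and the mutated V2b prove that every elliptic curve with a big-image good ordinary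
prime `p ≥ 5` has analytic rank `≤ 1`: K supplies `n ∈ 𝒩_k` with `δ_n^{(k)} ≠ 0`; if `r_an ≥ 2` then
`n = 1` is killed by V0, a wrong-parity `n` by V1, `ν(n) = 1` with `r_an` odd by V2a (`r_an ≥ 3`), and
every remaining `n` (`ν ≥ 2`, right parity) by the mutated V2b — contradiction. The conclusion is
false on paper (389a1 at `p = 5` has `r_an = 2`), so the mutation is fatal; in Lean it is not a
refutation only because no curve has a certified analytic rank `≥ 2`. [folklore] -/
theorem analyticRank_le_one_of_noUpper (hK : StubKimOrderLeCorank) (hV0 : StubDeltaOne)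
    (hV1 : StubDeltaParity) (hV2a : StubDeltaPrimeOfOddRank) (hNo : StubDeltaEvenGapNoUpper) :
    ∀ (W : WeierstrassCurve ℚ) [W.IsElliptic] [W.IsGloballyMinimal] (p : ℕ) [Fact p.Prime],
      5 ≤ p → W.HasGoodReductionAtPrime p → ¬ (p : ℤ) ∣ W.frobeniusTrace p →
      W.HasSurjectiveModNGaloisRep p → W.analyticRank ≤ 1 := by
  intro W _ _ p _ h5 hgood hord hsurj
  by_contra hr
  push Not at hr
  obtain ⟨hN, f, hf, k, n, hn0, hk, hkoly, _, ψ, hψ, hne⟩ := hK W p h5 hgood hord hsurj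
  haveI := hn0
  apply hne
  rcases eq_or_ne n 1 with rfl | hn1
  · exact hV0 W p hN f hf (by omega) k ψ
  · rcases Nat.even_or_odd (n.primeFactors.card + W.analyticRank) with he | ho
    · have h1 : 1 ≤ n.primeFactors.card := one_le_card_primeFactors hn0.out hn1
      rcases h1.eq_or_lt with h1' | h2
      · -- ν(n) = 1 and 1 + r_an even: r_an odd, and ≥ 3 since ≥ 2
        have hodd : Odd W.analyticRank := by
          rw [← h1'] at he
          exact (Nat.even_add_one (n := W.analyticRank)).mp (by simpa [add_comm] using he) |>
            Nat.not_even_iff_odd.mp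
        have h3 : 3 ≤ W.analyticRank := by
          obtain ⟨m, hm⟩ := hodd
          omega
        exact hV2a W p h5 hgood hord hsurj hN f hf k n hk hkoly h1'.symm hodd h3 ψ hψ
      · exact hNo W p h5 hgood hord hsurj hN f hf k n hk hkoly h2 he ψ hψ
    · exact hV1 W p h5 hgood hord hsurj hN f hf k n hk hkoly (Nat.not_even_iff_odd.mpr ho) ψ hψ

/-- Hence, given the summit as well (so that `r_an = rank`), the mutated stub set says that no curve
in the crux's range has Mordell–Weil rank ≥ 2 — recorded as the sharpest available in-tree form of
"dropping `ν < r_an` is fatal". [folklore] -/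
theorem mordellWeilRank_le_one_of_noUpper_of_summit (hS : _root_.BirchSwinnertonDyer)
    (hK : StubKimOrderLeCorank) (hV0 : StubDeltaOne) (hV1 : StubDeltaParity)
    (hV2a : StubDeltaPrimeOfOddRank) (hNo : StubDeltaEvenGapNoUpper) :
    ∀ (W : WeierstrassCurve ℚ) [W.IsElliptic] [W.IsGloballyMinimal] (p : ℕ) [Fact p.Prime],
      5 ≤ p → W.HasGoodReductionAtPrime p → ¬ (p : ℤ) ∣ W.frobeniusTrace p →
      W.HasSurjectiveModNGaloisRep p → W.mordellWeilRank ≤ 1 := by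
  intro W _ _ p _ h5 hgood hord hsurj
  have h1 : W.analyticRank = W.mordellWeilRank := hS W inferInstance
  have := analyticRank_le_one_of_noUpper hK hV0 hV1 hV2a hNo W p h5 hgood hord hsurj
  omega

/-! ## (C) Tightness of the crux inequality: strict exactly on the divisible part of `Ш[p^∞]` -/

/-- **Where `r_an ≤ corank` is an equality.** Given the summit, `corank_p Sel_{p^∞}(W) = r_an(W)` iff
`corank_{ℤ_p} Ш(W)[p^∞] = 0` (e.g. `Ш[p^∞]` finite), and the crux inequality is STRICT exactly when
`Ш(W)[p^∞]` has a divisible part: the LB half carries no information about `Ш`, the UB half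
(`SelmerRankUB`) carries all of it. [folklore] -/
theorem selmerCorank_eq_analyticRank_iff_of_summit (hS : _root_.BirchSwinnertonDyer)
    (W : WeierstrassCurve ℚ) [W.IsElliptic] (p : ℕ) [Fact p.Prime] :
    W.selmerCorank p = W.analyticRank ↔ W.shaCorank p = 0 := by
  have h1 : W.analyticRank = W.mordellWeilRank := hS W inferInstance
  have h2 : W.selmerCorank p = W.mordellWeilRank + W.shaCorank p :=
    W.selmerCorank_eq_mordellWeilRank_add_holds p
  omega

end Summit.BirchSwinnertonDyer.BirchSwinnertonDyer.Cruxes.SelmerRankLB.Disproof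

end
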